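import Summits.BirchSwinnertonDyer.BirchSwinnertonDyer.Theorems.UniversalToricDescentTorsionMuTransport
import Summits.BirchSwinnertonDyer.Rank1Residual.X11b.AnticyclotomicEmbedding
import Literature.NumberTheory.EllipticCurves.HeegnerPointsKolyvaginGoodReductionProofs
import Literature.NumberTheory.EllipticCurves.ModularityVersionApProofs
import Literature.NumberTheory.EllipticCurves.AnticyclotomicPrimeDecompositionSplitProofs
import Literature.NumberTheory.EllipticCurves.AnticyclotomicPrimeDecompositionAboveProofs
import Literature.NumberTheory.DiophantineGeometry.LocalReductionFiniteBadPlacesProofs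
import HarnessLib

/-!
# Route UniversalToricDescent — child B′1 `TorsionMuTransportModThree` of crux 20399 / `InvariantsTransportModThreeT`
# in the route's EXACT binders: imaginary quadratic `K`, Heegner hypotheses for `N` and `N′`, the
# anticyclotomic `ℤ_p`-extension, `𝔭 ∋ p` — the decomposition hypotheses DISCHARGED by Brink

Lead prover bsd-wall-utd-p1 g6 (`--supports stmt-BirchSwinnertonDyer-20399`; PRICING-20399-ALG-HALF-utdp1g5 §3(a),
typed text HOME/bsd-wall-utd-p1/Split20399_B1_text_utdp1g5.lean). Instantiation of
`UniversalToricDescentTorsionMuTransport.isTorsion_and_exists_generator_empty_transfer_of_modPCongruent`: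
* `not_decomp_le_kerSubgroup_of_not_hasGoodReductionAt_baseChange` — for `W/ℚ` of conductor `N`, `K` imaginary
  quadratic satisfying the Heegner hypothesis for `N`, `κ` anticyclotomic, `p` odd: a place `v ∤ p` of `K` at
  which `W_K` has BAD reduction is finitely decomposed in `K_∞` (`D_v ⊄ ker κ`) — bad over `K` ⟹ bad over
  `ℚ` at `ℓ_v` (`hasGoodReductionAt_baseChange_of_hasGoodReductionAt_rat`) ⟹ `ℓ_v ∣ N`
  (`dvd_conductorNorm_iff`) ⟹ `ℓ_v` splits in `K` (Heegner) ⟹ `e(v) = f(v) = 1` (`degreeOne_of_splitsIn`)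
  ⟹ Brink Thm. 2 (`decomp_not_le_kerSubgroup_of_isAnticyclotomic_holds`, route leaf 20465);
* **`torsionMuTransport_of_heegner`** (any odd `p`) and **`torsionMuTransportModThree`** (`p = 3`): the
  statement of B′1 — `W, W′/ℚ` elliptic, `ModPCongruent W′ W p`, conductors `N, N′`, `K` imaginary quadratic
  with Heegner for `N` and `N′`, `κ` anticyclotomic with topological generator `γ`, `𝔭 ∋ p` (finitely
  decomposed by Brink Cor. 1, leaf 20466): `X_ac^∅(W′_K)` `Λ`-torsion with `Ch_Λ·R₀⟦T⟧ = (g′)`, `g′` with a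
  norm-one coefficient ⟹ the same for `X_ac^∅(W_K)`. (B′1's further binders — `ClassO6`, surjectivity of
  `ρ̄_{E,3}`, global minimality, `r_an` — are not needed.)

THEOREMS ONLY; no definition, no named fact, no `sorry`. BSD is not advanced by this file (B′1 is the
algebraic half of 20399/T). References: [GreenbergVatsal2000] Thm. (1.4) (algebraic half), §2 Prop. (2.4),
(2.8); [Brink2007] Thm. 2, Cor. 1; [Castella2018] §2.1 (`N = N⁺N⁻`), Def. 2.2; [SilvermanAEC2009] VII.5.1.
-/

set_option autoImplicit false
-- `…BirchSwinnertonDyer.BirchSwinnertonDyer.Theorems…` is the problem's mandated namespace (D-0017).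
set_option linter.dupNamespace false

noncomputable section

open scoped Classical

namespace Summit.BirchSwinnertonDyer.BirchSwinnertonDyer.Theorems.UniversalToricDescentTorsionMuTransportHeegner

open NumberField IsDedekindDomain Field
open Literature.NumberTheory.EllipticCurves Literature.NumberTheory.EllipticCurves.GreenbergSelmer
  Literature.NumberTheory.GaloisRepresentations WeierstrassCurve
  Summit.BirchSwinnertonDyer.Rank1Residual.X11b Summit.BirchSwinnertonDyer.Rank1Residual.X11b.AcSelmer
  Summit.BirchSwinnertonDyer.Rank1Residual.O6
  Summit.BirchSwinnertonDyer.BirchSwinnertonDyer.Theorems.UniversalToricDescentTorsionMuTransport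

/-- **Bad places of `W_K` prime to `p` are finitely decomposed in the anticyclotomic tower, under the
Heegner hypothesis.** `W/ℚ` elliptic of conductor `N`; `K` imaginary quadratic in which every prime
dividing `N` splits; `κ` the anticyclotomic `ℤ_p`-extension, `p` odd; `v ∤ p` a place of `K` where
`W_K = W.baseChange K` has bad reduction. Then `D_v ⊄ ker κ`. [cite: Brink2007, Thm. 2 (pp. 2134–2135)]
[cite: Castella2018, §2.1 (`N⁺` = the split part of `N`)] [cite: SilvermanAEC2009, VII.5 Prop. 5.1] -/
theorem not_decomp_le_kerSubgroup_of_not_hasGoodReductionAt_baseChange (W : WeierstrassCurve ℚ)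
    [W.IsElliptic] {N : ℕ} (hN : W.conductorNorm ℤ = N) (K : Type) [Field K] [NumberField K]
    (hK : IsImaginaryQuadratic K) (hH : SatisfiesHeegnerHypothesis N K) {p : ℕ} [Fact p.Prime]
    (hp : p ≠ 2) (κ : ZpExtension K p) (hκ : κ.IsAnticyclotomic) {v : HeightOneSpectrum (𝓞 K)}
    (hpv : ((p : ℕ) : 𝓞 K) ∉ v.asIdeal) (hbad : ¬ (W.baseChange K).HasGoodReductionAt v) :
    ¬ (decomp v ≤ κ.kerSubgroup) := by
  -- the rational place below `v` and its prime `ℓ`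
  set u : HeightOneSpectrum (𝓞 ℚ) := v.under (𝓞 ℚ) with hu
  haveI : v.asIdeal.LiesOver u.asIdeal := ⟨(HeightOneSpectrum.under_asIdeal (𝓞 ℚ) v).symm⟩
  have hbadQ : ¬ W.HasGoodReductionAt u := fun hgood ↦
    hbad (hasGoodReductionAt_baseChange_of_hasGoodReductionAt_rat W u v hgood)
  set ℓ : Nat.Primes := Rat.HeightOneSpectrum.primesEquiv u with hℓ
  have hℓN : (ℓ : ℕ) ∣ N := by
    rw [← hN]
    exact (W.dvd_conductorNorm_iff u).mpr hbadQ
  haveI : Fact (ℓ : ℕ).Prime := ⟨ℓ.2⟩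
  -- `ℓ` splits in `K`, so `v` has degree one
  have hs : SplitsIn K (ℓ : ℕ) := hH ℓ ℓ.2 hℓN
  have hvℓ : (((ℓ : ℕ) : ℕ) : 𝓞 K) ∈ v.asIdeal := by
    apply mem_of_under_eq_ratPlace
    rw [ratPlace, ← hu]
    exact (Equiv.symm_apply_apply _ u).symm
  obtain ⟨he, hf⟩ := degreeOne_of_splitsIn hK.1 hs hvℓ
  exact ZpExtension.decomp_not_le_kerSubgroup_of_isAnticyclotomic_holds K p hK hp κ hκ v hpv he hf

/-- **B′1 `TorsionMuTransportModThree`, any odd `p`, in the route's binders.** `W, W′/ℚ` elliptic with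
`W′[p] ≅ W[p]` (`ModPCongruent W′ W p`), conductors `N, N′`; `K` imaginary quadratic satisfying the Heegner
hypothesis for `N` and for `N′`; `κ` the anticyclotomic `ℤ_p`-extension with topological generator `γ`;
`𝔭 ∋ p`. If `X_ac^∅(W′_K) = AcSelmer.XAc (W′.baseChange K) p κ 𝔭 ∅ γ` is `Λ`-torsion with
`Ch_Λ·R₀⟦T⟧ = (g′)`, `g′` with a norm-one coefficient, then so is `X_ac^∅(W_K)`. All decomposition
hypotheses of the generic theorem are discharged: `D_𝔭 ⊄ ker κ` (Brink Cor. 1), and for `Σ` = the places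
prime to `p` where `W_K` or `W′_K` is bad, `D_v ⊄ ker κ` (`not_decomp_le_kerSubgroup_of_not_hasGoodReductionAt_baseChange`).
[cite: GreenbergVatsal2000, Thm. (1.4) (algebraic half); §2 Prop. (2.4), (2.8)] [cite: Brink2007, Thm. 2 and Cor. 1] -/
theorem torsionMuTransport_of_heegner (W W' : WeierstrassCurve ℚ) [W.IsElliptic] [W'.IsElliptic]
    {N N' : ℕ} (K : Type) [Field K] [NumberField K] {p : ℕ} [Fact p.Prime] (hp : p ≠ 2)
    (hN : W.conductorNorm ℤ = N) (hcong : ModPCongruent W' W p) (hN' : W'.conductorNorm ℤ = N')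
    (hK : IsImaginaryQuadratic K) (hH : SatisfiesHeegnerHypothesis N K)
    (hH' : SatisfiesHeegnerHypothesis N' K) (κ : ZpExtension K p) (hκ : κ.IsAnticyclotomic)
    (γ : absoluteGaloisGroup K) [Fact (κ.IsTopGenerator γ)] (𝔭 : HeightOneSpectrum (𝓞 K))
    (h𝔭 : ((p : ℕ) : 𝓞 K) ∈ 𝔭.asIdeal)
    (hT' : Module.IsTorsion (IwasawaAlgebra p) (XAc (W'.baseChange K) p κ 𝔭 ∅ γ))
    (hg' : ∃ g : UnrSeries p,
      (XAc.charIdeal (W'.baseChange K) p κ 𝔭 ∅ γ).map (PowerSeries.map (Halves.toUnr p)) =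
          Ideal.span {g} ∧
        ∃ i : ℕ, ‖((PowerSeries.coeff i g : unrIntegers p) : ℂ_[p])‖ = 1) :
    Module.IsTorsion (IwasawaAlgebra p) (XAc (W.baseChange K) p κ 𝔭 ∅ γ) ∧
      ∃ g : UnrSeries p,
        (XAc.charIdeal (W.baseChange K) p κ 𝔭 ∅ γ).map (PowerSeries.map (Halves.toUnr p)) =
            Ideal.span {g} ∧
          ∃ i : ℕ, ‖((PowerSeries.coeff i g : unrIntegers p) : ℂ_[p])‖ = 1 := by
  -- `Σ` := the places prime to `p` where one of the two curves has bad reduction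
  let S : Set (HeightOneSpectrum (𝓞 K)) := {v | ((p : ℕ) : 𝓞 K) ∉ v.asIdeal ∧
    (¬ (W.baseChange K).HasGoodReductionAt v ∨ ¬ (W'.baseChange K).HasGoodReductionAt v)}
  have hSfin : S.Finite := by
    refine (((W.baseChange K).finite_badPlaces_holds (𝓞 K)).union
      ((W'.baseChange K).finite_badPlaces_holds (𝓞 K))).subset fun v hv ↦ ?_
    rcases hv.2 with h | h
    · exact Or.inl h
    · exact Or.inr h
  have hSp : ∀ v ∈ S, ((p : ℕ) : 𝓞 K) ∉ v.asIdeal := fun v hv ↦ hv.1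
  have hSdec : ∀ v ∈ S, ¬ (decomp v ≤ κ.kerSubgroup) := by
    intro v hv
    rcases hv.2 with h | h
    · exact not_decomp_le_kerSubgroup_of_not_hasGoodReductionAt_baseChange W hN K hK hH hp κ hκ hv.1 h
    · exact not_decomp_le_kerSubgroup_of_not_hasGoodReductionAt_baseChange W' hN' K hK hH' hp κ hκ
        hv.1 h
  have hgood : ∀ v : HeightOneSpectrum (𝓞 K), v ∉ S → ((p : ℕ) : 𝓞 K) ∉ v.asIdeal →
      (W.baseChange K).HasGoodReductionAt v := fun v hv hpv ↦ by
    by_contra h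
    exact hv ⟨hpv, Or.inl h⟩
  have hgood' : ∀ v : HeightOneSpectrum (𝓞 K), v ∉ S → ((p : ℕ) : 𝓞 K) ∉ v.asIdeal →
      (W'.baseChange K).HasGoodReductionAt v := fun v hv hpv ↦ by
    by_contra h
    exact hv ⟨hpv, Or.inr h⟩
  have h𝔭dec : ¬ (decomp 𝔭 ≤ κ.kerSubgroup) :=
    ZpExtension.decomp_not_le_kerSubgroup_above_of_isAnticyclotomic_holds K p hK hp κ hκ 𝔭 h𝔭
  exact isTorsion_and_exists_generator_empty_transfer_of_modPCongruent W W' K κ 𝔭 γ S hp h𝔭 h𝔭dec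
    hSfin hSp hSdec hgood hgood' hcong hT' hg'

/-- **B′1 `TorsionMuTransportModThree` at `p = 3`** (the route's crux #2 / 20399 / 21845 setting: the twin
`W′` with `W′[3] ≅ W[3]`, `K` a Heegner field for `N` and `N′`, `κ` anticyclotomic, `𝔭′ ∋ 3`): `Λ`-torsion and
`μ = 0` of `X_{∅,0}(W_K/K_∞)` follow from those of `X_{∅,0}(W′_K/K_∞)`. [cite: GreenbergVatsal2000, Thm. (1.4) (algebraic half); §2 Prop. (2.8)] -/
theorem torsionMuTransportModThree (W W' : WeierstrassCurve ℚ) [W.IsElliptic] [W'.IsElliptic]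
    {N N' : ℕ} (K : Type) [Field K] [NumberField K]
    (hN : W.conductorNorm ℤ = N) (hcong : ModPCongruent W' W 3) (hN' : W'.conductorNorm ℤ = N')
    (hK : IsImaginaryQuadratic K) (hH : SatisfiesHeegnerHypothesis N K)
    (hH' : SatisfiesHeegnerHypothesis N' K) (κ : ZpExtension K 3) (hκ : κ.IsAnticyclotomic)
    (γ : absoluteGaloisGroup K) [Fact (κ.IsTopGenerator γ)] (𝔭' : HeightOneSpectrum (𝓞 K))
    (h𝔭' : ((3 : ℕ) : 𝓞 K) ∈ 𝔭'.asIdeal)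
    (hT' : Module.IsTorsion (IwasawaAlgebra 3) (XAc (W'.baseChange K) 3 κ 𝔭' ∅ γ))
    (hg' : ∃ g : UnrSeries 3,
      (XAc.charIdeal (W'.baseChange K) 3 κ 𝔭' ∅ γ).map (PowerSeries.map (Halves.toUnr 3)) =
          Ideal.span {g} ∧
        ∃ i : ℕ, ‖((PowerSeries.coeff i g : unrIntegers 3) : ℂ_[3])‖ = 1) :
    Module.IsTorsion (IwasawaAlgebra 3) (XAc (W.baseChange K) 3 κ 𝔭' ∅ γ) ∧
      ∃ g : UnrSeries 3,
        (XAc.charIdeal (W.baseChange K) 3 κ 𝔭' ∅ γ).map (PowerSeries.map (Halves.toUnr 3)) =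
            Ideal.span {g} ∧
          ∃ i : ℕ, ‖((PowerSeries.coeff i g : unrIntegers 3) : ℂ_[3])‖ = 1 :=
  torsionMuTransport_of_heegner W W' K (by norm_num) hN hcong hN' hK hH hH' κ hκ γ 𝔭' h𝔭' hT' hg'

end Summit.BirchSwinnertonDyer.BirchSwinnertonDyer.Theorems.UniversalToricDescentTorsionMuTransportHeegner

end
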